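import Summits.QuantumFields.BalabanUV.Beta.FP.TorusCompositeIndexWardTwo
import Summits.QuantumFields.BalabanUV.Beta.FP.PeriodisedSymCompositeIndexWardTwoPure

/-!
# `BalabanUV.Beta.FP.TorusCompositeIndexWardTwoLetter` — road «FP» for binder row D1, ROUTE T, (T-β-m) ORDER 2 AT EVERY DEPTH, PART 3:
# **#21's `q2` LETTER BY TERM FOR THE COMPOSITE AVERAGING — `X̄X̄𝔔₀ + 2(X̄𝔔₁ + X̄𝔔₀X) + 𝔔₂ + 2𝔔₁X + 𝔔₀XX = 𝔔′₂`, `𝔔′₂` THE SAME WORD ALONG `h + Dλ`**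
# (the order-2 twin of my g22 `TorusCompositeIndexWardOne.torus_q1_tower`; consumer: the OWNER d1-p3's `j ≥ 2` assembly of #21 `NestedStepLawTorusCompositeOneShotTop`)

WHY.  #21 displays `q2 : Xbar * Xbar * 𝔔₀ + (Xbar * 𝔔₁ + Xbar * 𝔔₀ * X) + ((Xbar * 𝔔₁ + Xbar * 𝔔₀ * X) + (𝔔₂ + 𝔔₁ * X + (𝔔₁ * X + 𝔔₀ * (X * X)))) = 𝔔′₂` with the namings
`h𝔔₀ h𝔔₁ h𝔔₂` of the composite averaging's jets (`Q₁₀ := compRows`, `Q₁₁ := c • compIns₁ h` (C2), `Q₁₂ := c² • compIns₂ h` (I-5), `Q₂₀ ∕ Q₂₁ ∕ Q₂₂` the top step's rows ∕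
member ∕ ♭ bi-member along the transported direction `(cθ_{n+1})•(compRows·h)` (C2 ∕ I-5)).  With `X := −(c • E_λ)` (#21's `hX`) and `X̄ := c • R′_λ` (g22's), the word
on the left IS the composite's second jet at the gauge-shifted direction `h′ = h + Dλ` — the four SHIFT letters: `Q₁₁` (g22 `compIns₁_pureGauge_fun`), `Q₂₁` (g18
`torus_pureGauge_fun_of_presentation` one level up, as in g22's `torus_q1_tower`), `Q₁₂` (PART 2 `compIns₂_pureGauge_shift`), `Q₂₂` (PART 1's bi-weighted forms ONE
LEVEL UP in the door's `(pμ′, mμ′)` presentation + g18), fed to my g24 `PeriodisedSymCompositeIndexWardTwoPure.q2_sim_word_pure` (pure algebra, reused AS IS).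

WHAT.  §1 the four shift letters `torus_Q11_tower_shift`, `torus_Q21_tower_shift`, `torus_Q12_tower_shift`, `torus_Q22_tower_shift`; §2 **`torus_q2_tower`**.
[folklore] finite sums + matrix algebra BY NAME; no `def`, no `def … : Prop`, nothing cited, 0 sorry.  Nothing of the dictionary ∕ Bałaban's asserted (the ♭ objects
`compIns₂` ∕ the one-summand `Q₂₂` are OURS and CANDIDATE, R-FP-63 (v); that they are Bałaban's composite second jets is an2's TABLE word ∕ the junction's).

HONEST DEPENDENCY (page 1, mandatory): continuum YM on T⁴ ⇐ BetaPertH ∧ nine spine estimates (0/9 proved); BetaPertH ⇐ (D1) ∧ (D4) ∧ CAP+tail;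
G-an2-4 gates asym, D1 and NE2/3/4.  HONEST FRAMING (cell contract, verbatim): «discharging `BetaPertH` makes Bałaban's UV stability UNCONDITIONAL —
a real constructive-QFT result; it is NOT the continuum limit and NOT the Clay problem.»  ABSOLUTE RULE (cell charter, verbatim): «No internally-minted
statement may enter as a cited fact. Every hypothesis is either kernel-proved in this package or a verbatim quotation of a PUBLISHED theorem with page
reference. The manuscript(s) under audit are NOT citable for their own disputed steps — they are the thing under adjudication; programme-internal
(2001/route/tribunal) claims are never citable.»  0 estimates; 0∕4 row-D1 binders (hW, hR, D1Tel, D1Rep); NOT (T-ID), NOT (J-a) complete, NOT SDF, NOT D1,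
NOT BetaPertH, NOT continuum, NOT Clay.  D1 formalisation swarm LEAF PROVER 02 (b2b-balaban-beta-d1-formalise-leaf-02 gen 26), 2026-08-23.  No existing file touched.
-/

noncomputable section

open scoped BigOperators

namespace Summit.QuantumFields.BalabanUV.Beta.FP.TorusCompositeIndexWardTwoLetter

open Matrix Finset
open Literature.MathematicalPhysics.QuantumFieldTheory
open Literature.MathematicalPhysics.QuantumFieldTheory.Balaban1983to89
open Literature.MathematicalPhysics.QuantumFieldTheory.Balaban1983to89.Beta
open ExpKernelCalculus (MKer)
open B4TorusKernel.MultiPeriod (translate)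
open B5Prop11Plancherel (fine)
open B6Lemma24Torus (pbox)
open AffineAveraging (Site box toSite unitVec)
open AveragingHessianKernelsRooted (vhSAt)
open AveragingMixedJetTables (vh₂SAt)
open OneStepResolventKernel (Fib)
open Summit.QuantumFields.BalabanUV.Beta.BorderedHessian (bhKStepAt stepScale stepScale_ne_zero)
open Summit.QuantumFields.BalabanUV.Beta.FP.KernelPeriodisationFib (Idx perF)
open Summit.QuantumFields.BalabanUV.Beta.FP.KernelPeriodisationFibLoc (dper)
open Summit.QuantumFields.BalabanUV.Beta.FP.TorusGaugeCovariance (tdelta tgrad)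
open Summit.QuantumFields.BalabanUV.Beta.FP.PeriodisedBorderIndexWard (torus_pureGauge_fun_of_presentation)
open Summit.QuantumFields.BalabanUV.Beta.FP.TorusCompositeObjects
open Summit.QuantumFields.BalabanUV.Beta.FP.TorusCompositeCovariance (itRoot)
open Summit.QuantumFields.BalabanUV.Beta.FP.TorusCompositeCovarianceOne (compIns₁ prod_stepScale_mul_card_ne_zero')
open Summit.QuantumFields.BalabanUV.Beta.FP.TorusCompositeCovarianceTwo (compIns₂)
open Summit.QuantumFields.BalabanUV.Beta.FP.TorusCompositeIndexWardOne (compIns₁_add compIns₁_pureGauge_fun compRows_mulVec_tgrad_fun)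
open Summit.QuantumFields.BalabanUV.Beta.FP.PeriodisedBorderIndexWardTwo (torus_T2_gauge_fst_of_presentation torus_T2_gauge_snd_of_presentation)
open Summit.QuantumFields.BalabanUV.Beta.FP.TorusCompositeIndexWardTwo (compIns₂_pureGauge_shift)
open Summit.QuantumFields.BalabanUV.Beta.FP.PeriodisedSymCompositeIndexWardTwo (sum_sum_add_mul_mul_add_mul_smul)
open Summit.QuantumFields.BalabanUV.Beta.FP.PeriodisedSymCompositeIndexWardTwoPure (q2_sim_word_pure)

variable {d : ℕ}

section Letter

variable (Lc : ℕ) [NeZero Lc] (M' : Fin (d + 1) → ℕ) [∀ μ, NeZero (M' μ)] (lev : ℕ → ℕ) (rs : ℕ → (Fin (d + 1) → ℕ))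

/-! ## §1 The four shift letters of the composite's jets -/

/-- [folklore] **`Q₁₁` SHIFT** (g22 `compIns₁_add ∕ compIns₁_pureGauge_fun`): `c • compIns₁ h′ = c • compIns₁ h + c • (R·C − C·E)`, `h′ = h + Dλ`. -/
theorem torus_Q11_tower_shift (hrs : ∀ k, rs k ∈ box (d + 1) Lc) (n : ℕ) (c : ℝ) (h : ↥(pbox (towerTorus Lc M' (n + 1))) × Fin (d + 1) → ℝ) (lam : ↥(pbox (towerTorus Lc M' (n + 1))) → ℝ) :
    c • compIns₁ Lc M' lev rs (n + 1) (fun b : ↥(pbox (towerTorus Lc M' (n + 1))) × Fin (d + 1) => h b + ∑ s : ↥(pbox (towerTorus Lc M' (n + 1))), tgrad (towerTorus Lc M' (n + 1)) (b.1, Sum.inl b.2) s * lam s)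
      = c • compIns₁ Lc M' lev rs (n + 1) h + c • (Matrix.diagonal (fun a : ↥(pbox M') × Fin (d + 1) => lam (itRoot Lc M' rs hrs (n + 1) a.1)) * compRows Lc M' lev rs (n + 1) - compRows Lc M' lev rs (n + 1) * Matrix.diagonal (fun b : ↥(pbox (towerTorus Lc M' (n + 1))) × Fin (d + 1) => lam b.1)) := by
  show c • compIns₁ Lc M' lev rs (n + 1) (h + fun b : ↥(pbox (towerTorus Lc M' (n + 1))) × Fin (d + 1) => ∑ s : ↥(pbox (towerTorus Lc M' (n + 1))), tgrad (towerTorus Lc M' (n + 1)) (b.1, Sum.inl b.2) s * lam s) = _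
  rw [compIns₁_add, compIns₁_pureGauge_fun Lc (n + 1) M' lev rs hrs lam, smul_add]

/-- [folklore] **`Q₁₂` SHIFT** (PART 2 `compIns₂_pureGauge_shift`, rescaled by `c²`): `c² • compIns₂ h′ = c² • compIns₂ h + c • ((R·(c•compIns₁ h) − (c•compIns₁ h)·E) + (same))
+ c • (R·(c•(R C − C E)) − (c•(R C − C E))·E)`. -/
theorem torus_Q12_tower_shift (hrs : ∀ k, rs k ∈ box (d + 1) Lc) (n : ℕ) (c : ℝ) (h : ↥(pbox (towerTorus Lc M' (n + 1))) × Fin (d + 1) → ℝ) (lam : ↥(pbox (towerTorus Lc M' (n + 1))) → ℝ) :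
    c ^ 2 • compIns₂ Lc M' lev rs (n + 1) (fun b : ↥(pbox (towerTorus Lc M' (n + 1))) × Fin (d + 1) => h b + ∑ s : ↥(pbox (towerTorus Lc M' (n + 1))), tgrad (towerTorus Lc M' (n + 1)) (b.1, Sum.inl b.2) s * lam s)
      = c ^ 2 • compIns₂ Lc M' lev rs (n + 1) h
        + c • ((Matrix.diagonal (fun a : ↥(pbox M') × Fin (d + 1) => lam (itRoot Lc M' rs hrs (n + 1) a.1)) * (c • compIns₁ Lc M' lev rs (n + 1) h) - (c • compIns₁ Lc M' lev rs (n + 1) h) * Matrix.diagonal (fun b : ↥(pbox (towerTorus Lc M' (n + 1))) × Fin (d + 1) => lam b.1))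
          + (Matrix.diagonal (fun a : ↥(pbox M') × Fin (d + 1) => lam (itRoot Lc M' rs hrs (n + 1) a.1)) * (c • compIns₁ Lc M' lev rs (n + 1) h) - (c • compIns₁ Lc M' lev rs (n + 1) h) * Matrix.diagonal (fun b : ↥(pbox (towerTorus Lc M' (n + 1))) × Fin (d + 1) => lam b.1))
          + c • (Matrix.diagonal (fun a : ↥(pbox M') × Fin (d + 1) => lam (itRoot Lc M' rs hrs (n + 1) a.1)) * (Matrix.diagonal (fun a : ↥(pbox M') × Fin (d + 1) => lam (itRoot Lc M' rs hrs (n + 1) a.1)) * compRows Lc M' lev rs (n + 1) - compRows Lc M' lev rs (n + 1) * Matrix.diagonal (fun b : ↥(pbox (towerTorus Lc M' (n + 1))) × Fin (d + 1) => lam b.1)) - (Matrix.diagonal (fun a : ↥(pbox M') × Fin (d + 1) => lam (itRoot Lc M' rs hrs (n + 1) a.1)) * compRows Lc M' lev rs (n + 1) - compRows Lc M' lev rs (n + 1) * Matrix.diagonal (fun b : ↥(pbox (towerTorus Lc M' (n + 1))) × Fin (d + 1) => lam b.1)) * Matrix.diagonal (fun b : ↥(pbox (towerTorus Lc M' (n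 + 1))) × Fin (d + 1) => lam b.1))) := by
  rw [compIns₂_pureGauge_shift Lc (n + 1) M' lev rs hrs h lam]
  simp only [smul_add, smul_sub, Matrix.mul_smul, Matrix.smul_mul, Matrix.mul_sub, Matrix.sub_mul, smul_smul, Matrix.mul_assoc, pow_two]
  module

/-- [folklore] **`Q₂₁` SHIFT** (g22's letter inside `torus_q1_tower`, extracted): the top step's member along the transported direction `(cθ_{n+1})•(C·w)` shifts by
`c • (R′·Q₂₀ − Q₂₀·R)` — linearity, `C·(Dλ) = σ_{n+1}•D(λ∘itRoot)` (g22 `compRows_mulVec_tgrad_fun`), g18 `torus_pureGauge_fun_of_presentation` one level up in the door's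
`(pμ′, mμ′)` presentation, and `c·θ_{n+1}·σ_{n+1}·c_{lev 0} = c`. -/
theorem torus_Q21_tower_shift (hrs : ∀ k, rs k ∈ box (d + 1) Lc) (hM' : ∀ i, Lc ∣ M' i) (n : ℕ) (c : ℝ) (h : ↥(pbox (towerTorus Lc M' (n + 1))) × Fin (d + 1) → ℝ) (lam : ↥(pbox (towerTorus Lc M' (n + 1))) → ℝ)
    {κ : Type*} [Fintype κ] [DecidableEq κ] (pμ' : κ → ↥(pbox M')) (mμ' : κ → Fin (d + 1))
    {Q₂₀ : Matrix κ (↥(pbox M') × Fin (d + 1)) ℝ}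
    (hQ₂₀ : Q₂₀ = (perF M' (bhKStepAt d (toSite (rs 0)) Lc (lev 0))).submatrix (fun k : κ => ((pμ' k, Sum.inr (mμ' k)) : Idx M' (Fib d)))
        (fun b : ↥(pbox M') × Fin (d + 1) => ((b.1, Sum.inl b.2) : Idx M' (Fib d))))
    (Q₂₁ : (↥(pbox (towerTorus Lc M' (n + 1))) × Fin (d + 1) → ℝ) → Matrix κ (↥(pbox M') × Fin (d + 1)) ℝ)
    (hQ₂₁ : ∀ w, Q₂₁ w = ∑ a' : ↥(pbox M') × Fin (d + 1), ((c * (((Lc : ℝ) ^ (d + 1) * stepScale d Lc (lev 0)) * (∏ i ∈ range (n + 1), (stepScale d Lc (lev (i + 1)) * ((box (d + 1) Lc).card : ℝ)))⁻¹)) * (compRows Lc M' lev rs (n + 1) *ᵥ w) a') •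
        (perF M' (dper M' (vhSAt (toSite (rs 0)) d Lc rfl a'.2 (a'.1 : Site (d + 1))))).submatrix (fun k : κ => ((pμ' k, Sum.inr (mμ' k)) : Idx M' (Fib d)))
          (fun b : ↥(pbox M') × Fin (d + 1) => ((b.1, Sum.inl b.2) : Idx M' (Fib d)))) :
    Q₂₁ (fun b : ↥(pbox (towerTorus Lc M' (n + 1))) × Fin (d + 1) => h b + ∑ s : ↥(pbox (towerTorus Lc M' (n + 1))), tgrad (towerTorus Lc M' (n + 1)) (b.1, Sum.inl b.2) s * lam s)
      = Q₂₁ h + c • (Matrix.diagonal (fun α : κ => ∑ t : ↥(pbox M'), tdelta M' ((pμ' α : Site (d + 1)) + toSite (rs 0)) t * lam (itRoot Lc M' rs hrs (n + 1) t)) * Q₂₀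
          - Q₂₀ * Matrix.diagonal (fun a : ↥(pbox M') × Fin (d + 1) => lam (itRoot Lc M' rs hrs (n + 1) a.1))) := by
  have hB : (box (d + 1) Lc).Nonempty := ⟨rs 0, hrs 0⟩
  have hσ := prod_stepScale_mul_card_ne_zero' Lc hB (fun i => lev (i + 1)) (n + 1)
  have hL : ((Lc : ℝ) ^ (d + 1) * stepScale d Lc (lev 0)) ≠ 0 := mul_ne_zero (pow_ne_zero _ (by exact_mod_cast NeZero.ne Lc)) (stepScale_ne_zero _)
  have hθ : (c * (((Lc : ℝ) ^ (d + 1) * stepScale d Lc (lev 0)) * (∏ i ∈ range (n + 1), (stepScale d Lc (lev (i + 1)) * ((box (d + 1) Lc).card : ℝ)))⁻¹)) * (∏ i ∈ range (n + 1), (stepScale d Lc (lev (i + 1)) * ((box (d + 1) Lc).card : ℝ))) * ((Lc : ℝ) ^ (d + 1) * stepScale d Lc (lev 0))⁻¹ = c := by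
    rw [show (c * (((Lc : ℝ) ^ (d + 1) * stepScale d Lc (lev 0)) * (∏ i ∈ range (n + 1), (stepScale d Lc (lev (i + 1)) * ((box (d + 1) Lc).card : ℝ)))⁻¹)) * (∏ i ∈ range (n + 1), (stepScale d Lc (lev (i + 1)) * ((box (d + 1) Lc).card : ℝ))) * ((Lc : ℝ) ^ (d + 1) * stepScale d Lc (lev 0))⁻¹ = c * (((Lc : ℝ) ^ (d + 1) * stepScale d Lc (lev 0)) * ((Lc : ℝ) ^ (d + 1) * stepScale d Lc (lev 0))⁻¹) * ((∏ i ∈ range (n + 1), (stepScale d Lc (lev (i + 1)) * ((box (d + 1) Lc).card : ℝ))) * (∏ i ∈ range (n + 1), (stepScale d Lc (lev (i + 1)) * ((box (d + 1) Lc).card : ℝ)))⁻¹) by ring, mul_inv_cancel₀ hσ, mul_inv_cancel₀ hL, mul_one, mul_one]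
  rw [hQ₂₁, hQ₂₁]
  show (∑ a' : ↥(pbox M') × Fin (d + 1), ((c * (((Lc : ℝ) ^ (d + 1) * stepScale d Lc (lev 0)) * (∏ i ∈ range (n + 1), (stepScale d Lc (lev (i + 1)) * ((box (d + 1) Lc).card : ℝ)))⁻¹)) * (compRows Lc M' lev rs (n + 1) *ᵥ (h + fun b : ↥(pbox (towerTorus Lc M' (n + 1))) × Fin (d + 1) => ∑ s : ↥(pbox (towerTorus Lc M' (n + 1))), tgrad (towerTorus Lc M' (n + 1)) (b.1, Sum.inl b.2) s * lam s)) a') •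
      (perF M' (dper M' (vhSAt (toSite (rs 0)) d Lc rfl a'.2 (a'.1 : Site (d + 1))))).submatrix (fun k : κ => ((pμ' k, Sum.inr (mμ' k)) : Idx M' (Fib d)))
          (fun b : ↥(pbox M') × Fin (d + 1) => ((b.1, Sum.inl b.2) : Idx M' (Fib d)))) = _
  rw [Matrix.mulVec_add, compRows_mulVec_tgrad_fun Lc (n + 1) M' lev rs hrs lam]
  rw [Finset.sum_congr rfl fun a' _ => by
    rw [show ((c * (((Lc : ℝ) ^ (d + 1) * stepScale d Lc (lev 0)) * (∏ i ∈ range (n + 1), (stepScale d Lc (lev (i + 1)) * ((box (d + 1) Lc).card : ℝ)))⁻¹)) * (compRows Lc M' lev rs (n + 1) *ᵥ h + (∏ i ∈ range (n + 1), (stepScale d Lc (lev (i + 1)) * ((box (d + 1) Lc).card : ℝ))) • (fun a : ↥(pbox M') × Fin (d + 1) => ∑ t : ↥(pbox M'), tgrad M' (a.1, Sum.inl a.2) t * lam (itRoot Lc M' rs hrs (n + 1) t))) a')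
        = (c * (((Lc : ℝ) ^ (d + 1) * stepScale d Lc (lev 0)) * (∏ i ∈ range (n + 1), (stepScale d Lc (lev (i + 1)) * ((box (d + 1) Lc).card : ℝ)))⁻¹)) * (compRows Lc M' lev rs (n + 1) *ᵥ h) a' + ((c * (((Lc : ℝ) ^ (d + 1) * stepScale d Lc (lev 0)) * (∏ i ∈ range (n + 1), (stepScale d Lc (lev (i + 1)) * ((box (d + 1) Lc).card : ℝ)))⁻¹)) * (∏ i ∈ range (n + 1), (stepScale d Lc (lev (i + 1)) * ((box (d + 1) Lc).card : ℝ)))) * ∑ t : ↥(pbox M'), tgrad M' (a'.1, Sum.inl a'.2) t * lam (itRoot Lc M' rs hrs (n + 1) t) from by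
          simp only [Pi.add_apply, Pi.smul_apply, smul_eq_mul]; ring,
      add_smul, mul_smul ((c * (((Lc : ℝ) ^ (d + 1) * stepScale d Lc (lev 0)) * (∏ i ∈ range (n + 1), (stepScale d Lc (lev (i + 1)) * ((box (d + 1) Lc).card : ℝ)))⁻¹)) * (∏ i ∈ range (n + 1), (stepScale d Lc (lev (i + 1)) * ((box (d + 1) Lc).card : ℝ)))) (∑ t : ↥(pbox M'), tgrad M' (a'.1, Sum.inl a'.2) t * lam (itRoot Lc M' rs hrs (n + 1) t))],
    Finset.sum_add_distrib, ← Finset.smul_sum]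
  have hlaw := torus_pureGauge_fun_of_presentation (M := M') (M'' := fun i => M' i / Lc) (fun i => (Nat.mul_div_cancel' (hM' i)).symm) (hrs 0) (lev 0)
      (fun t => lam (itRoot Lc M' rs hrs (n + 1) t)) (fun k : κ => (pμ' k : Site (d + 1))) (fun k => (pμ' k).2) mμ' hQ₂₀
  simp only [Subtype.coe_eta] at hlaw
  rw [hlaw, smul_smul, hθ]

/-- [folklore] **`Q₂₂` SHIFT — THE TOP STEP's ♭ BI-MEMBER ALONG THE TRANSPORTED, GAUGE-SHIFTED DIRECTION** (PART 1's bi-weighted forms `torus_T2_gauge_fst ∕ snd_of_presentation`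
ONE LEVEL UP in the door's `(pμ′, mμ′)` presentation for the cross terms, PART 1 + g18 for the gauge–gauge term; `(cθσ)·c_{lev 0} = c`, `c_{lev 0}·(cθσ)²·c_{lev 0} = c²`):
`Q₂₂ h′ h′ = Q₂₂ h h + (c • (R′·Q₂₁ h − Q₂₁ h·R) + c • (same)) + c • (R′·(c • (R′Q₂₀ − Q₂₀R)) − (c • (R′Q₂₀ − Q₂₀R))·R)` — `q2_sim_word_pure`'s `hT′` shape. -/
theorem torus_Q22_tower_shift (hrs : ∀ k, rs k ∈ box (d + 1) Lc) (hM' : ∀ i, Lc ∣ M' i) (n : ℕ) (c : ℝ) (h : ↥(pbox (towerTorus Lc M' (n + 1))) × Fin (d + 1) → ℝ) (lam : ↥(pbox (towerTorus Lc M' (n + 1))) → ℝ)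
    {κ : Type*} [Fintype κ] [DecidableEq κ] (pμ' : κ → ↥(pbox M')) (mμ' : κ → Fin (d + 1))
    {Q₂₀ : Matrix κ (↥(pbox M') × Fin (d + 1)) ℝ}
    (hQ₂₀ : Q₂₀ = (perF M' (bhKStepAt d (toSite (rs 0)) Lc (lev 0))).submatrix (fun k : κ => ((pμ' k, Sum.inr (mμ' k)) : Idx M' (Fib d)))
        (fun b : ↥(pbox M') × Fin (d + 1) => ((b.1, Sum.inl b.2) : Idx M' (Fib d))))
    (Q₂₁ : (↥(pbox (towerTorus Lc M' (n + 1))) × Fin (d + 1) → ℝ) → Matrix κ (↥(pbox M') × Fin (d + 1)) ℝ)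
    (hQ₂₁ : ∀ w, Q₂₁ w = ∑ a' : ↥(pbox M') × Fin (d + 1), ((c * (((Lc : ℝ) ^ (d + 1) * stepScale d Lc (lev 0)) * (∏ i ∈ range (n + 1), (stepScale d Lc (lev (i + 1)) * ((box (d + 1) Lc).card : ℝ)))⁻¹)) * (compRows Lc M' lev rs (n + 1) *ᵥ w) a') •
        (perF M' (dper M' (vhSAt (toSite (rs 0)) d Lc rfl a'.2 (a'.1 : Site (d + 1))))).submatrix (fun k : κ => ((pμ' k, Sum.inr (mμ' k)) : Idx M' (Fib d)))
          (fun b : ↥(pbox M') × Fin (d + 1) => ((b.1, Sum.inl b.2) : Idx M' (Fib d))))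
    (Q₂₂ : (↥(pbox (towerTorus Lc M' (n + 1))) × Fin (d + 1) → ℝ) → (↥(pbox (towerTorus Lc M' (n + 1))) × Fin (d + 1) → ℝ) → Matrix κ (↥(pbox M') × Fin (d + 1)) ℝ)
    (hQ₂₂ : ∀ w w', Q₂₂ w w' = ((Lc : ℝ) ^ (d + 1) * stepScale d Lc (lev 0))⁻¹ •
        ∑ b : ↥(pbox M') × Fin (d + 1), ∑ b' : ↥(pbox M') × Fin (d + 1), (((c * (((Lc : ℝ) ^ (d + 1) * stepScale d Lc (lev 0)) * (∏ i ∈ range (n + 1), (stepScale d Lc (lev (i + 1)) * ((box (d + 1) Lc).card : ℝ)))⁻¹)) * (compRows Lc M' lev rs (n + 1) *ᵥ w) b) * ((c * (((Lc : ℝ) ^ (d + 1) * stepScale d Lc (lev 0)) * (∏ i ∈ range (n + 1), (stepScale d Lc (lev (i + 1)) * ((box (d + 1) Lc).card : ℝ)))⁻¹)) * (compRows Lc M' lev rs (n + 1) *ᵥ w') b')) •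
          (perF M' (dper M' (fun x z a e => ∑' m : Site (d + 1), (1 / 2 : ℝ) *
            (vh₂SAt (toSite (rs 0)) Lc b.2 (b.1 : Site (d + 1)) b'.2 (translate M' (b'.1 : Site (d + 1)) m) x z a e
              + vh₂SAt (toSite (rs 0)) Lc b'.2 (translate M' (b'.1 : Site (d + 1)) m) b.2 (b.1 : Site (d + 1)) x z a e)))).submatrix
            (fun k : κ => ((pμ' k, Sum.inr (mμ' k)) : Idx M' (Fib d))) (fun e : ↥(pbox M') × Fin (d + 1) => ((e.1, Sum.inl e.2) : Idx M' (Fib d)))) :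
    Q₂₂ (fun b : ↥(pbox (towerTorus Lc M' (n + 1))) × Fin (d + 1) => h b + ∑ s : ↥(pbox (towerTorus Lc M' (n + 1))), tgrad (towerTorus Lc M' (n + 1)) (b.1, Sum.inl b.2) s * lam s) (fun b : ↥(pbox (towerTorus Lc M' (n + 1))) × Fin (d + 1) => h b + ∑ s : ↥(pbox (towerTorus Lc M' (n + 1))), tgrad (towerTorus Lc M' (n + 1)) (b.1, Sum.inl b.2) s * lam s)
      = Q₂₂ h h
        + (c • (Matrix.diagonal (fun α : κ => ∑ t : ↥(pbox M'), tdelta M' ((pμ' α : Site (d + 1)) + toSite (rs 0)) t * lam (itRoot Lc M' rs hrs (n + 1) t)) * Q₂₁ h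
              - Q₂₁ h * Matrix.diagonal (fun a : ↥(pbox M') × Fin (d + 1) => lam (itRoot Lc M' rs hrs (n + 1) a.1)))
          + c • (Matrix.diagonal (fun α : κ => ∑ t : ↥(pbox M'), tdelta M' ((pμ' α : Site (d + 1)) + toSite (rs 0)) t * lam (itRoot Lc M' rs hrs (n + 1) t)) * Q₂₁ h
              - Q₂₁ h * Matrix.diagonal (fun a : ↥(pbox M') × Fin (d + 1) => lam (itRoot Lc M' rs hrs (n + 1) a.1))))
        + c • (Matrix.diagonal (fun α : κ => ∑ t : ↥(pbox M'), tdelta M' ((pμ' α : Site (d + 1)) + toSite (rs 0)) t * lam (itRoot Lc M' rs hrs (n + 1) t))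
              * (c • (Matrix.diagonal (fun α : κ => ∑ t : ↥(pbox M'), tdelta M' ((pμ' α : Site (d + 1)) + toSite (rs 0)) t * lam (itRoot Lc M' rs hrs (n + 1) t)) * Q₂₀
                  - Q₂₀ * Matrix.diagonal (fun a : ↥(pbox M') × Fin (d + 1) => lam (itRoot Lc M' rs hrs (n + 1) a.1))))
            - (c • (Matrix.diagonal (fun α : κ => ∑ t : ↥(pbox M'), tdelta M' ((pμ' α : Site (d + 1)) + toSite (rs 0)) t * lam (itRoot Lc M' rs hrs (n + 1) t)) * Q₂₀
                  - Q₂₀ * Matrix.diagonal (fun a : ↥(pbox M') × Fin (d + 1) => lam (itRoot Lc M' rs hrs (n + 1) a.1))))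
              * Matrix.diagonal (fun a : ↥(pbox M') × Fin (d + 1) => lam (itRoot Lc M' rs hrs (n + 1) a.1))) := by
  have hB : (box (d + 1) Lc).Nonempty := ⟨rs 0, hrs 0⟩
  have hσ := prod_stepScale_mul_card_ne_zero' Lc hB (fun i => lev (i + 1)) (n + 1)
  have hL : ((Lc : ℝ) ^ (d + 1) * stepScale d Lc (lev 0)) ≠ 0 := mul_ne_zero (pow_ne_zero _ (by exact_mod_cast NeZero.ne Lc)) (stepScale_ne_zero _)
  have hM : ∀ i, M' i = Lc * (M' i / Lc) := fun i => (Nat.mul_div_cancel' (hM' i)).symm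
  -- the scalar identities `c₀·(cθσ) = c` and `c₀·(cθσ)²·c₀ = c²` (`θσ·c₀ = 1`)
  have hθσ : (c * (((Lc : ℝ) ^ (d + 1) * stepScale d Lc (lev 0)) * (∏ i ∈ range (n + 1), (stepScale d Lc (lev (i + 1)) * ((box (d + 1) Lc).card : ℝ)))⁻¹)) * (∏ i ∈ range (n + 1), (stepScale d Lc (lev (i + 1)) * ((box (d + 1) Lc).card : ℝ))) = c * ((Lc : ℝ) ^ (d + 1) * stepScale d Lc (lev 0)) := by
    rw [show (c * (((Lc : ℝ) ^ (d + 1) * stepScale d Lc (lev 0)) * (∏ i ∈ range (n + 1), (stepScale d Lc (lev (i + 1)) * ((box (d + 1) Lc).card : ℝ)))⁻¹)) * (∏ i ∈ range (n + 1), (stepScale d Lc (lev (i + 1)) * ((box (d + 1) Lc).card : ℝ))) = c * ((Lc : ℝ) ^ (d + 1) * stepScale d Lc (lev 0)) * ((∏ i ∈ range (n + 1), (stepScale d Lc (lev (i + 1)) * ((box (d + 1) Lc).card : ℝ)))⁻¹ * (∏ i ∈ range (n + 1), (stepScale d Lc (lev (i + 1)) * ((box (d + 1) Lc).card : ℝ))))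 by ring, inv_mul_cancel₀ hσ, mul_one]
  have k1 : ((Lc : ℝ) ^ (d + 1) * stepScale d Lc (lev 0))⁻¹ * (c * ((Lc : ℝ) ^ (d + 1) * stepScale d Lc (lev 0))) = c := by
    rw [show ((Lc : ℝ) ^ (d + 1) * stepScale d Lc (lev 0))⁻¹ * (c * ((Lc : ℝ) ^ (d + 1) * stepScale d Lc (lev 0))) = c * (((Lc : ℝ) ^ (d + 1) * stepScale d Lc (lev 0))⁻¹ * ((Lc : ℝ) ^ (d + 1) * stepScale d Lc (lev 0))) by ring, inv_mul_cancel₀ hL, mul_one]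
  have hLc : (Lc : ℝ) ≠ 0 := by exact_mod_cast NeZero.ne Lc
  have hst : stepScale d Lc (lev 0) ≠ 0 := stepScale_ne_zero _
  -- PART 1's bi-family one level up, and `Q₂₂` in its letters
  obtain ⟨W, hW⟩ : ∃ W : Fin (d + 1) → Site (d + 1) → Fin (d + 1) → Site (d + 1) → MKer (d + 1) (Fib d),
      W = fun κ' u' κ u x z a e => ∑' m : Site (d + 1), (1 / 2 : ℝ) * (vh₂SAt (toSite (rs 0)) Lc κ u κ' (translate M' u' m) x z a e
        + vh₂SAt (toSite (rs 0)) Lc κ' (translate M' u' m) κ u x z a e) := ⟨_, rfl⟩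
  have hT : ∀ w w' : ↥(pbox (towerTorus Lc M' (n + 1))) × Fin (d + 1) → ℝ, Q₂₂ w w' = ((Lc : ℝ) ^ (d + 1) * stepScale d Lc (lev 0))⁻¹ •
      ∑ b : ↥(pbox M') × Fin (d + 1), ∑ b' : ↥(pbox M') × Fin (d + 1), (((c * (((Lc : ℝ) ^ (d + 1) * stepScale d Lc (lev 0)) * (∏ i ∈ range (n + 1), (stepScale d Lc (lev (i + 1)) * ((box (d + 1) Lc).card : ℝ)))⁻¹)) * (compRows Lc M' lev rs (n + 1) *ᵥ w) b) * ((c * (((Lc : ℝ) ^ (d + 1) * stepScale d Lc (lev 0)) * (∏ i ∈ range (n + 1), (stepScale d Lc (lev (i + 1)) * ((box (d + 1) Lc).card : ℝ)))⁻¹)) * (compRows Lc M' lev rs (n + 1) *ᵥ w') b')) •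
        (perF M' (dper M' (W b'.2 (b'.1 : Site (d + 1)) b.2 (b.1 : Site (d + 1))))).submatrix
          (fun k : κ => (((⟨(pμ' k : Site (d + 1)), (pμ' k).2⟩ : ↥(pbox M')), Sum.inr (mμ' k)) : Idx M' (Fib d)))
          (fun e : ↥(pbox M') × Fin (d + 1) => ((e.1, Sum.inl e.2) : Idx M' (Fib d))) := fun w w' => by
    rw [hQ₂₂]; subst hW; rfl
  -- the transported, shifted direction: `(cθ)•C(h + Dλ) = (cθ)•Ch + (c·A₀)•D(λ∘itRoot)`
  have e1 : ∀ b : ↥(pbox M') × Fin (d + 1), (c * (((Lc : ℝ) ^ (d + 1) * stepScale d Lc (lev 0)) * (∏ i ∈ range (n + 1), (stepScale d Lc (lev (i + 1)) * ((box (d + 1) Lc).card : ℝ)))⁻¹)) * (compRows Lc M' lev rs (n + 1) *ᵥ (fun b : ↥(pbox (towerTorus Lc M' (n + 1))) × Fin (d + 1) => h b + ∑ s : ↥(pbox (towerTorus Lc M' (n + 1))), tgrad (towerTorus Lc M' (n + 1)) (b.1, Sum.inl b.2) s * lam s)) b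
      = (c * (((Lc : ℝ) ^ (d + 1) * stepScale d Lc (lev 0)) * (∏ i ∈ range (n + 1), (stepScale d Lc (lev (i + 1)) * ((box (d + 1) Lc).card : ℝ)))⁻¹)) * (compRows Lc M' lev rs (n + 1) *ᵥ h) b + (c * ((Lc : ℝ) ^ (d + 1) * stepScale d Lc (lev 0))) * (∑ t : ↥(pbox M'), tgrad M' (b.1, Sum.inl b.2) t * lam (itRoot Lc M' rs hrs (n + 1) t)) := by
    intro b
    rw [show (fun b : ↥(pbox (towerTorus Lc M' (n + 1))) × Fin (d + 1) => h b + ∑ s : ↥(pbox (towerTorus Lc M' (n + 1))), tgrad (towerTorus Lc M' (n + 1)) (b.1, Sum.inl b.2) s * lam s) = h + (fun b : ↥(pbox (towerTorus Lc M' (n + 1))) × Fin (d + 1) => ∑ s : ↥(pbox (towerTorus Lc M' (n + 1))), tgrad (towerTorus Lc M' (n + 1)) (b.1, Sum.inl b.2) s * lam s) from rfl,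
      Matrix.mulVec_add, compRows_mulVec_tgrad_fun Lc (n + 1) M' lev rs hrs lam, ← hθσ]
    simp only [Pi.add_apply, Pi.smul_apply, smul_eq_mul]
    ring
  -- the member along the transported direction in PART 1's letters, and g18's law for the member along the pure gauge
  have hQ₂₁' : (∑ b' : ↥(pbox M') × Fin (d + 1), ((c * (((Lc : ℝ) ^ (d + 1) * stepScale d Lc (lev 0)) * (∏ i ∈ range (n + 1), (stepScale d Lc (lev (i + 1)) * ((box (d + 1) Lc).card : ℝ)))⁻¹)) * (compRows Lc M' lev rs (n + 1) *ᵥ h) b') •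
      (perF M' (dper M' (vhSAt (toSite (rs 0)) d Lc rfl b'.2 (b'.1 : Site (d + 1))))).submatrix
        (fun k : κ => (((⟨(pμ' k : Site (d + 1)), (pμ' k).2⟩ : ↥(pbox M')), Sum.inr (mμ' k)) : Idx M' (Fib d)))
        (fun e : ↥(pbox M') × Fin (d + 1) => ((e.1, Sum.inl e.2) : Idx M' (Fib d)))) = Q₂₁ h := by
    rw [hQ₂₁]
  have hlaw := torus_pureGauge_fun_of_presentation (M := M') (M'' := fun i => M' i / Lc) hM (hrs 0) (lev 0)
      (fun t => lam (itRoot Lc M' rs hrs (n + 1) t)) (fun k : κ => (pμ' k : Site (d + 1))) (fun k => (pμ' k).2) mμ' hQ₂₀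
  rw [hT, hT h h]
  simp only [e1]
  rw [sum_sum_add_mul_mul_add_mul_smul,
    torus_T2_gauge_fst_of_presentation (M := M') (M' := fun i => M' i / Lc) (hrs 0) hM hW (fun k : κ => (pμ' k : Site (d + 1))) (fun k => (pμ' k).2) mμ' _
      (fun t => lam (itRoot Lc M' rs hrs (n + 1) t)),
    torus_T2_gauge_snd_of_presentation (M := M') (M' := fun i => M' i / Lc) (hrs 0) hM hW (fun k : κ => (pμ' k : Site (d + 1))) (fun k => (pμ' k).2) mμ' _
      (fun t => lam (itRoot Lc M' rs hrs (n + 1) t)),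
    torus_T2_gauge_fst_of_presentation (M := M') (M' := fun i => M' i / Lc) (hrs 0) hM hW (fun k : κ => (pμ' k : Site (d + 1))) (fun k => (pμ' k).2) mμ' _
      (fun t => lam (itRoot Lc M' rs hrs (n + 1) t)),
    hQ₂₁', hlaw]
  simp only [Subtype.coe_eta]
  simp only [smul_add, smul_sub, Matrix.mul_smul, Matrix.smul_mul, Matrix.mul_sub, Matrix.sub_mul, smul_smul, Matrix.mul_assoc, k1]
  match_scalars <;> field_simp

/-! ## §2 The door's `q2` letter for the composite averaging -/

/-- [folklore] **`torus_q2_tower` — #21's `q2 : X̄X̄𝔔₀ + (X̄𝔔₁ + X̄𝔔₀X) + ((X̄𝔔₁ + X̄𝔔₀X) + (𝔔₂ + 𝔔₁X + (𝔔₁X + 𝔔₀XX))) = 𝔔′₂` FOR THE COMPOSITE AVERAGING AT EVERY DEPTH**: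
`hX` = #21's VERBATIM, `X̄ := c • diagonal (Σ_t tdelta M′ (pμ′ α + toSite (rs 0)) t · λ (itRoot (n+1) t))` and `hQ₂₀ hQ₂₁ h𝔔₀ h𝔔₁` = g22 `torus_q1_tower`'s VERBATIM,
`hQ₂₂` = I-5's ♭ one-summand bi-member (`c_{lev 0} •` the top step's symmetrised rooted pair along `(cθ_{n+1})•(compRows·w)` and `(cθ_{n+1})•(compRows·w′)`),
`h𝔔₂ : Q₂₂ h h·compRows + Q₂₁ h·(c•compIns₁ h) + (Q₂₁ h·(c•compIns₁ h) + Q₂₀·(c²•compIns₂ h)) = 𝔔₂` (#21's `h𝔔₂` at C2 ∕ I-5's `hQ₁₁ hQ₁₂`), and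
`𝔔′₂ := Q₂₂ h′ h′·compRows + Q₂₁ h′·(c•compIns₁ h′) + (Q₂₁ h′·(c•compIns₁ h′) + Q₂₀·(c²•compIns₂ h′))`, `h′ = h + Dλ` — my g24 `q2_sim_word_pure` fed §1's four shift letters. -/
theorem torus_q2_tower (hrs : ∀ k, rs k ∈ box (d + 1) Lc) (hM' : ∀ i, Lc ∣ M' i) (n : ℕ) (c : ℝ) (h : ↥(pbox (towerTorus Lc M' (n + 1))) × Fin (d + 1) → ℝ) (lam : ↥(pbox (towerTorus Lc M' (n + 1))) → ℝ)
    {κ : Type*} [Fintype κ] [DecidableEq κ] (pμ' : κ → ↥(pbox M')) (mμ' : κ → Fin (d + 1))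
    {Q₂₀ : Matrix κ (↥(pbox M') × Fin (d + 1)) ℝ}
    (hQ₂₀ : Q₂₀ = (perF M' (bhKStepAt d (toSite (rs 0)) Lc (lev 0))).submatrix (fun k : κ => ((pμ' k, Sum.inr (mμ' k)) : Idx M' (Fib d)))
        (fun b : ↥(pbox M') × Fin (d + 1) => ((b.1, Sum.inl b.2) : Idx M' (Fib d))))
    (Q₂₁ : (↥(pbox (towerTorus Lc M' (n + 1))) × Fin (d + 1) → ℝ) → Matrix κ (↥(pbox M') × Fin (d + 1)) ℝ)
    (hQ₂₁ : ∀ w, Q₂₁ w = ∑ a' : ↥(pbox M') × Fin (d + 1), ((c * (((Lc : ℝ) ^ (d + 1) * stepScale d Lc (lev 0)) * (∏ i ∈ range (n + 1), (stepScale d Lc (lev (i + 1)) * ((box (d + 1) Lc).card : ℝ)))⁻¹)) * (compRows Lc M' lev rs (n + 1) *ᵥ w) a') •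
        (perF M' (dper M' (vhSAt (toSite (rs 0)) d Lc rfl a'.2 (a'.1 : Site (d + 1))))).submatrix (fun k : κ => ((pμ' k, Sum.inr (mμ' k)) : Idx M' (Fib d)))
          (fun b : ↥(pbox M') × Fin (d + 1) => ((b.1, Sum.inl b.2) : Idx M' (Fib d))))
    (Q₂₂ : (↥(pbox (towerTorus Lc M' (n + 1))) × Fin (d + 1) → ℝ) → (↥(pbox (towerTorus Lc M' (n + 1))) × Fin (d + 1) → ℝ) → Matrix κ (↥(pbox M') × Fin (d + 1)) ℝ)
    (hQ₂₂ : ∀ w w', Q₂₂ w w' = ((Lc : ℝ) ^ (d + 1) * stepScale d Lc (lev 0))⁻¹ •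
        ∑ b : ↥(pbox M') × Fin (d + 1), ∑ b' : ↥(pbox M') × Fin (d + 1), (((c * (((Lc : ℝ) ^ (d + 1) * stepScale d Lc (lev 0)) * (∏ i ∈ range (n + 1), (stepScale d Lc (lev (i + 1)) * ((box (d + 1) Lc).card : ℝ)))⁻¹)) * (compRows Lc M' lev rs (n + 1) *ᵥ w) b) * ((c * (((Lc : ℝ) ^ (d + 1) * stepScale d Lc (lev 0)) * (∏ i ∈ range (n + 1), (stepScale d Lc (lev (i + 1)) * ((box (d + 1) Lc).card : ℝ)))⁻¹)) * (compRows Lc M' lev rs (n + 1) *ᵥ w') b')) •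
          (perF M' (dper M' (fun x z a e => ∑' m : Site (d + 1), (1 / 2 : ℝ) *
            (vh₂SAt (toSite (rs 0)) Lc b.2 (b.1 : Site (d + 1)) b'.2 (translate M' (b'.1 : Site (d + 1)) m) x z a e
              + vh₂SAt (toSite (rs 0)) Lc b'.2 (translate M' (b'.1 : Site (d + 1)) m) b.2 (b.1 : Site (d + 1)) x z a e)))).submatrix
            (fun k : κ => ((pμ' k, Sum.inr (mμ' k)) : Idx M' (Fib d))) (fun e : ↥(pbox M') × Fin (d + 1) => ((e.1, Sum.inl e.2) : Idx M' (Fib d))))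
    {X : Matrix (↥(pbox (towerTorus Lc M' (n + 1))) × Fin (d + 1)) (↥(pbox (towerTorus Lc M' (n + 1))) × Fin (d + 1)) ℝ} (hX : X = -(c • Matrix.diagonal (fun b : ↥(pbox (towerTorus Lc M' (n + 1))) × Fin (d + 1) => lam b.1)))
    {Xbar : Matrix κ κ ℝ}
    (hXbar : Xbar = c • Matrix.diagonal (fun α : κ => ∑ t : ↥(pbox M'), tdelta M' ((pμ' α : Site (d + 1)) + toSite (rs 0)) t * lam (itRoot Lc M' rs hrs (n + 1) t)))
    {𝔔₀ 𝔔₁ 𝔔₂ : Matrix κ (↥(pbox (towerTorus Lc M' (n + 1))) × Fin (d + 1)) ℝ} (h𝔔₀ : Q₂₀ * compRows Lc M' lev rs (n + 1) = 𝔔₀)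
    (h𝔔₁ : Q₂₁ h * compRows Lc M' lev rs (n + 1) + Q₂₀ * (c • compIns₁ Lc M' lev rs (n + 1) h) = 𝔔₁)
    (h𝔔₂ : Q₂₂ h h * compRows Lc M' lev rs (n + 1) + Q₂₁ h * (c • compIns₁ Lc M' lev rs (n + 1) h) + (Q₂₁ h * (c • compIns₁ Lc M' lev rs (n + 1) h) + Q₂₀ * (c ^ 2 • compIns₂ Lc M' lev rs (n + 1) h)) = 𝔔₂) :
    Xbar * Xbar * 𝔔₀ + (Xbar * 𝔔₁ + Xbar * 𝔔₀ * X) + ((Xbar * 𝔔₁ + Xbar * 𝔔₀ * X) + (𝔔₂ + 𝔔₁ * X + (𝔔₁ * X + 𝔔₀ * (X * X))))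
      = Q₂₂ (fun b : ↥(pbox (towerTorus Lc M' (n + 1))) × Fin (d + 1) => h b + ∑ s : ↥(pbox (towerTorus Lc M' (n + 1))), tgrad (towerTorus Lc M' (n + 1)) (b.1, Sum.inl b.2) s * lam s)
            (fun b : ↥(pbox (towerTorus Lc M' (n + 1))) × Fin (d + 1) => h b + ∑ s : ↥(pbox (towerTorus Lc M' (n + 1))), tgrad (towerTorus Lc M' (n + 1)) (b.1, Sum.inl b.2) s * lam s) * compRows Lc M' lev rs (n + 1)
        + Q₂₁ (fun b : ↥(pbox (towerTorus Lc M' (n + 1))) × Fin (d + 1) => h b + ∑ s : ↥(pbox (towerTorus Lc M' (n + 1))), tgrad (towerTorus Lc M' (n + 1)) (b.1, Sum.inl b.2) s * lam s) * (c • compIns₁ Lc M' lev rs (n + 1) (fun b : ↥(pbox (towerTorus Lc M' (n + 1))) × Fin (d + 1) => h b + ∑ s : ↥(pbox (towerTorus Lc M' (n + 1))), tgrad (towerTorus Lc M' (n + 1)) (b.1, Sum.inl b.2) s * lam s))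
        + (Q₂₁ (fun b : ↥(pbox (towerTorus Lc M' (n + 1))) × Fin (d + 1) => h b + ∑ s : ↥(pbox (towerTorus Lc M' (n + 1))), tgrad (towerTorus Lc M' (n + 1)) (b.1, Sum.inl b.2) s * lam s) * (c • compIns₁ Lc M' lev rs (n + 1) (fun b : ↥(pbox (towerTorus Lc M' (n + 1))) × Fin (d + 1) => h b + ∑ s : ↥(pbox (towerTorus Lc M' (n + 1))), tgrad (towerTorus Lc M' (n + 1)) (b.1, Sum.inl b.2) s * lam s))
          + Q₂₀ * (c ^ 2 • compIns₂ Lc M' lev rs (n + 1) (fun b : ↥(pbox (towerTorus Lc M' (n + 1))) × Fin (d + 1) => h b + ∑ s : ↥(pbox (towerTorus Lc M' (n + 1))), tgrad (towerTorus Lc M' (n + 1)) (b.1, Sum.inl b.2) s * lam s))) := by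
  subst h𝔔₀ h𝔔₁ h𝔔₂
  exact q2_sim_word_pure Q₂₀ (Q₂₁ h) (Q₂₂ h h) _ _ (compRows Lc M' lev rs (n + 1)) (c • compIns₁ Lc M' lev rs (n + 1) h) (c ^ 2 • compIns₂ Lc M' lev rs (n + 1) h) _ _ (Matrix.diagonal (fun b : ↥(pbox (towerTorus Lc M' (n + 1))) × Fin (d + 1) => lam b.1)) (Matrix.diagonal (fun a : ↥(pbox M') × Fin (d + 1) => lam (itRoot Lc M' rs hrs (n + 1) a.1)))
    (Matrix.diagonal (fun α : κ => ∑ t : ↥(pbox M'), tdelta M' ((pμ' α : Site (d + 1)) + toSite (rs 0)) t * lam (itRoot Lc M' rs hrs (n + 1) t))) c hX hXbar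
    (torus_Q11_tower_shift Lc M' lev rs hrs n c h lam) (torus_Q21_tower_shift Lc M' lev rs hrs hM' n c h lam pμ' mμ' hQ₂₀ Q₂₁ hQ₂₁)
    (torus_Q12_tower_shift Lc M' lev rs hrs n c h lam) (torus_Q22_tower_shift Lc M' lev rs hrs hM' n c h lam pμ' mμ' hQ₂₀ Q₂₁ hQ₂₁ Q₂₂ hQ₂₂)

end Letter

end Summit.QuantumFields.BalabanUV.Beta.FP.TorusCompositeIndexWardTwoLetter

end
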